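import Summits.BirchSwinnertonDyer.Rank1Residual.Additive.X4TamDefectLevelLoweringFromPrint
import Summits.BirchSwinnertonDyer.Rank1Residual.Additive.PlusSymbolIntegrality
import Literature.NumberTheory.EllipticCurves.NewformSymmSquareJ1728Hecke
import HarnessLib

/-!
# TAM-DEFECT₂ on the twist-good locus, census shape: `BSD(E,p)` for `E ≅ W₀ ⊗ χ_d` (`d > 0`) from published inputs, the geometric twist datum, and (MO)(OLD) on `f_{W₀}` (cell `b2b-bsdres`, seat additive-p4 gen 23, line V42, file K7)

HONEST FRAMING (verbatim, cell `b2b-bsdres`): the goal of the cell is to DELETE the COMBINATION-SHAPED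
residual classes for ALL analytic-rank `≤ 1` curves over `ℚ` — "full BSD formula for every rank `≤ 1`
curve in class `C`" assembled STRICTLY from published theorems — so that the rank-`≤ 1` remainder
becomes exactly the CONSTRUCTION-SHAPED classes, which are TYPED (missing-input Props), NOT attempted;
this is not "finishing BSD". This file: research-route KERNEL COMPOSITION; the displayed hypotheses
(MO)/(OLD) are predicates with parameters; nothing booked; X4 stays CONSTRUCTION-SHAPED.

## What is proved

`X4.bsdp_of_multiplicityOne_quadraticTwist_of_pos_of_five_le`: gen 23's END
(`bsdp_of_multiplicityOne_twist_of_tamagawa_le_two_of_shaAn_unit_of_five_le`, file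
`Additive/X4TamDefectLevelLoweringFromPrint.lean`) with the abstract twist data (`m`, `f₀`, `θ`, `hθW`,
`c₀`, `hsym`, `hint`) DISCHARGED from a GEOMETRIC twist datum — `C • W₀^{(d)} = E` with
`d ≡ 1 (mod 4)` square-free and POSITIVE, `W₀` good or multiplicative at the primes dividing `d`, the
newform `f₀` of `W₀` at a level `N₀ ∣ N`, `d² ∣ N`, `d ∣ N_E`, the period transfer for `W₀`, `W₀[p]`
irreducible — by the tree's own theorems: `exists_rat_ratPlusSymbol_eq_twistSum_of_pos` (the symbol
identity with ONE constant), `norm_ratCast_eq_one_of_twist_of_pos` (`|c₀|_p = 1`, Pal 2012 proved in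
the tree), `lFunction_quadraticTwist_apply_of_good_or_mult` (`a_q(E) = (q/d) a_q(W₀)`),
`Additive.norm_ratPlusSymbol_le_one_of_irreducible` (`p`-integral symbols). What remains displayed:
Kim 2026 Thm. 1.8 (6), Cassels–Tate, GZK, modularity (PUBLISHED named facts); the per-row numerals;
and **(MO) `ModPMultiplicityOne k N₀ θ̄_{W₀}`**, **(OLD) `HasOldEigenPlusSymb k N₀ θ̄_{W₀} ℓ w μ`** at a
prime `ℓ ∣ N_E` coprime to `d` with `w·ι((ℓ/d)) = 1` — IN PRINT when `p ∤ 2N₀` (the twist-good locus: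
29 of the 39 open twist-good TAM-DEFECT₂ unit cells at `p ≥ 5` have `d > 0`, 28 of them `d = 5`).
The `d < 0` twin (minus symbols) is `Additive/X4TamDefectLevelLoweringFromPrintMinus.lean`.

## References

* K. A. Ribet, Invent. Math. 100 (1990), Thm. 1.1, Thm. 5.2 (b). [cite: Ribet1990, Thm. 1.1 and Thm. 5.2 (b)]
* A. Pál, Canad. J. Math. 64 (2012), Thm. 3.2 with Prop. 2.5. [cite: Pal2012, Thm. 3.2 with Prop. 2.5]
* C.-H. Kim, Amer. J. Math. 148 (2026), Thm. 1.9 (6), Conj. 1.10. [cite: Kim2022StructureSelmer, Thm. 1.9 (6) and Conj. 1.10]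
* J. H. Silverman, AEC (2009), X.2, VII.5 Prop. 5.1, X.4.14. [cite: SilvermanAEC2009, X.2 and Thm. X.4.14]
-/

noncomputable section

open scoped MatrixGroups ModularForm NumberTheorySymbols NumberField

open CongruenceSubgroup Finset IsDedekindDomain

open Literature.NumberTheory.EllipticCurves Literature.NumberTheory.EllipticCurves.ModularForms
  Summit.BirchSwinnertonDyer.Rank1Residual.LevelLowering

namespace Summit.BirchSwinnertonDyer.Rank1Residual.X4

open Complex WeierstrassCurve Literature.NumberTheory.EllipticCurves.Rank1Residual
  Literature.NumberTheory.EllipticCurves.Rank1Residual.Typed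
  Summit.BirchSwinnertonDyer.Rank1Residual.Additive

variable {k : Type*} [CommRing k] [Nontrivial k]
  (W₀ W : WeierstrassCurve ℚ) [W₀.IsElliptic] [W₀.IsGloballyMinimal] [W.IsElliptic] [W.IsGloballyMinimal]
  (p : ℕ) [hp5 : Fact p.Prime] (ι : ZMod p →+* k)

/-- **TAM-DEFECT₂ ON THE TWIST-GOOD LOCUS (census shape, `d > 0`).** Let `E = W` be globally minimal
with `C • W₀^{(d)} = E` for a square-free `d ≡ 1 (mod 4)`, `d > 0`, `W₀` globally minimal and good or
multiplicative at the primes dividing `d`; `p ≥ 5`, `r_an(E) = 0`, `ρ̄_{E,p}` onto, a conductor-level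
datum `D` (`N = N_E`) with `p ∤ c_D` and the period transfer, `#Ш_an(E) = q'` a `p`-unit,
`ord_p ∏ c_v(E) ≤ 2`; the newform `f₀` of `W₀` at a level `N₀ ∣ N` with `d² ∣ N`, `d ∣ N`, the period
transfer for `W₀` and `W₀[p]` irreducible. IF the `θ̄_{W₀}`-eigen plus subspace of
`Symb_{Γ₀(N₀)}(Sym⁰ k)` has dimension `≤ 1` **(MO)** and contains the non-zero `ℓ`-old eigensymbol
`μ − w μ∘[ℓ]` **(OLD)** for a prime `ℓ ∣ N` coprime to `d` with `w·ι((ℓ/d)) = 1` and `μ` periodic,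
`T_q`-eigen at the Kolyvagin primes of `(E,p)` — both IN PRINT when `p ∤ 2N₀` — THEN **`BSD(E,p)`**,
from Kim 2026 Thm. 1.8 (6) + Cassels–Tate + GZK + modularity (PUBLISHED) and tree theorems only.
Nothing booked; X4 CONSTRUCTION-SHAPED. [cite: Kim2022StructureSelmer, Thm. 1.9 (6) and Conj. 1.10 (PDF p. 8)]
[cite: Ribet1990, Thm. 1.1 and Thm. 5.2 (b)] [cite: Pal2012, Thm. 3.2 with Prop. 2.5]
[cite: SilvermanAEC2009, Thm. X.4.14] [cite: Miller2011LMS, §1 and Def. 1.1] -/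
theorem bsdp_of_multiplicityOne_quadraticTwist_of_pos_of_five_le
    (hKimk : Kim2026.rankZero_le_padicValNat_sha_of_kuriharaNumber_ne_zero)
    (hE67c : Kim2026.rankZero_padicValNat_sha_add_le_of_forall_pow_dvd_kuriharaNumber_cyclicLevel)
    (hCT : exists_casselsTate_pairing (K := ℚ))
    (hGZK : rank_eq_analyticRank_of_analyticRank_le_one) (hmod : hasEntireLFunction_rat)
    (hp : 5 ≤ p) (hr : W.analyticRank = 0) (hsurj : W.HasSurjectiveModNGaloisRep p)
    {N : ℕ} [NeZero N] (D : ModularParametrizationData W N) (hN : W.conductorNorm ℤ = N)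
    (hc : ¬ (p : ℤ) ∣ D.maninConstant)
    (hper : ∃ u : ℚ, ‖(u : ℚ_[p])‖ = 1 ∧ W.realPeriodRat = u * plusPeriod D.f)
    {q' : ℚ} (hq' : shaAn W = (q' : ℂ)) (hv : padicValRat p q' = 0)
    (hc2 : padicValNat p W.tamagawaProduct ≤ 2)
    -- the geometric twist datum
    {d : ℤ} (hd4 : d % 4 = 1) (hsq : Squarefree d) (hd : 0 < d) (C : VariableChange ℚ)
    (hC : C • W₀.quadraticTwist (d : ℚ) = W)
    (hgm : ∀ v : HeightOneSpectrum (𝓞 ℚ), ((Rat.HeightOneSpectrum.primesEquiv v : ℕ) : ℤ) ∣ d →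
      W₀.HasGoodReductionAt v ∨ W₀.HasMultiplicativeReductionAt v)
    {N₀ : ℕ} [NeZero N₀] [NeZero d.natAbs] {f₀ : CuspForm (Gamma0 N₀) 2} (hf₀ : IsNewformOf W₀ f₀)
    (hN₀ : N₀ ∣ N) (hm : d.natAbs ^ 2 ∣ N) (hmN : d.natAbs ∣ W.conductorNorm ℤ)
    (hper₀ : ∃ u : ℚ, ‖(u : ℚ_[p])‖ = 1 ∧ W₀.realPeriodRat = u * plusPeriod f₀)
    (hirr₀ : W₀.HasIrreducibleModPGaloisRep p)
    -- the two displayed inputs on `f₀`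
    (hMO : ModPMultiplicityOne k N₀ (fun q ↦ ι ((W₀.LFunction q : ℤ) : ZMod p)))
    {ℓ : ℕ} {w : k} {μ : ℚ → k} (hℓN : ℓ ∣ W.conductorNorm ℤ) (hℓ : ℓ.Coprime d.natAbs)
    (hOLD : HasOldEigenPlusSymb k N₀ (fun q ↦ ι ((W₀.LFunction q : ℤ) : ZMod p)) ℓ w μ)
    (hμ : IsPeriodic μ)
    (hH : ∀ q : ℕ, Kato.IsKolyvaginPrime W p 1 q → HeckeRel μ q (ι ((W₀.LFunction q : ℤ) : ZMod p)))
    (hw : w * ι ((J((ℓ : ℤ) | d.natAbs) : ℤ) : ZMod p) = 1) : BSDp W p := by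
  have hp2 : p ≠ 2 := by omega
  have hfW : IsNewformOf W D.f := D.isNewformOf
  have hQ : coeffField f₀ = ⊥ := hf₀.coeffField_eq_bot
  have hΩ : plusPeriod f₀ ≠ 0 := (IsNewform0.exists_rat_smul_plusPeriod_holds hf₀.1 hQ).1
  have hint : ∀ x : ℚ, ¬ p ∣ (ratPlusSymbol f₀ x).den := fun x ↦
    not_dvd_den_of_norm_ratCast_le_one (Additive.norm_ratPlusSymbol_le_one_of_irreducible hp2 hf₀ hirr₀ x)
  have hadd := hasAdditiveReductionAt_quadraticTwist_of_good_or_mult W₀ hd4 hsq hgm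
  obtain ⟨c₀, hc₀, hrel⟩ :=
    exists_rat_ratPlusSymbol_eq_twistSum_of_pos W₀ W hd4 hsq hd ⟨C, hC⟩ hadd hf₀ hfW hN₀ hm
  -- `a_q(W₀) = (q/d) a_q(E)` at the Kolyvagin primes (good for `E`, coprime to `d`)
  have hθW : ∀ q : ℕ, Kato.IsKolyvaginPrime W p 1 q → ((W₀.LFunction q : ℤ) : ZMod p) =
      ((J((q : ℤ) | d.natAbs) : ℤ) : ZMod p) * (W.frobeniusTrace q : ZMod p) := by
    intro q hq
    have hqN : ¬ q ∣ N := fun h ↦ hq.not_dvd_conductorNorm (by rw [hN]; exact h)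
    have htr : (W.LFunction q : ℂ) = (W.frobeniusTrace q : ℂ) := by
      rw [← hfW.2 q, IsNewformOf.cuspCoeff_eq_frobeniusTrace_of_not_dvd hfW hq.prime hqN]
    have hd0 : d ≠ 0 := by rintro rfl; norm_num at hd4
    haveI : (W₀.quadraticTwist (d : ℚ)).IsElliptic := W₀.isElliptic_quadraticTwist (by exact_mod_cast hd0)
    have hLW : W.LFunction q = (W₀.quadraticTwist (d : ℚ)).LFunction q := by
      rw [← hC, LFunction_smul]
    have htr' : W.frobeniusTrace q = J((q : ℤ) | d.natAbs) * W₀.LFunction q := by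
      have h1 : W.LFunction q = W.frobeniusTrace q := by exact_mod_cast htr
      rw [← h1, hLW, lFunction_quadraticTwist_apply_of_good_or_mult W₀ hd4 hsq hgm q]
    have hqm : q.Coprime d.natAbs :=
      (Nat.Prime.coprime_iff_not_dvd hq.prime).mpr fun hdv ↦
        hq.not_dvd_conductorNorm ((hdv.trans hmN))
    have hJ : ((J((q : ℤ) | d.natAbs) : ℤ) : ZMod p) ^ 2 = 1 := by
      rw [← jacobiHom_natCast p, jacobiHom_natCast_sq_eq_one p hqm]
    rw [htr']
    push_cast
    linear_combination -(((W₀.LFunction q : ℤ) : ZMod p)) * hJ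
  by_cases hex : ∃ r : ℚ, ∑ u : ZMod d.natAbs, (J((u.val : ℤ) | d.natAbs) : ℚ) *
      ratPlusSymbol f₀ (r + (u.val : ℚ) / d.natAbs) ≠ 0
  · obtain ⟨uW, huW, hΩW⟩ := hper
    obtain ⟨u₀, hu₀, hΩ₀⟩ := hper₀
    have hunit : ‖(c₀ : ℚ_[p])‖ = 1 :=
      norm_ratCast_eq_one_of_twist_of_pos p W₀ W hd4 hsq hd C hC hgm huW hu₀ hΩW hΩ₀ (hrel hex)
    exact bsdp_of_multiplicityOne_twist_of_tamagawa_le_two_of_shaAn_unit_of_five_le W p ι hKimk hE67c hCT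
      hGZK hmod hp hr hsurj D hN hc ⟨uW, huW, hΩW⟩ hq' hv hc2 hmN hf₀.1 hQ hΩ hint
      (fun q ↦ W₀.LFunction q) (fun q _ ↦ (hf₀.2 q).symm) hθW c₀
      (not_dvd_den_of_norm_ratCast_le_one hunit.le) hc₀ hMO hℓN hℓ hOLD hμ hH hw
  · -- every twisted sum vanishes: the plus symbol of `D.f` is identically `0`, trivial certificate
    simp only [not_exists, not_not] at hex
    have hcert : PlusSymbolLevelLowersOver W p D.f ι ℓ :=
      ⟨0, fun _ _ ↦ rfl, fun q _ r ↦ by simp, fun r ↦ by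
        rw [hc₀ r, hex r, mul_zero, Rat.cast_zero, map_zero, Pi.zero_apply, Pi.zero_apply, sub_zero]⟩
    exact bsdp_of_plusSymbolLevelLowersOver_of_tamagawa_le_two_of_shaAn_unit_of_five_le W p hKimk hE67c hCT
      hGZK hmod hp hr hsurj D hN hc hper hq' hv hcert hℓN hc2

end Summit.BirchSwinnertonDyer.Rank1Residual.X4

end
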